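import Mathlib.RingTheory.PowerSeries.WeierstrassPreparation
import Mathlib.RingTheory.Polynomial.Eisenstein.Distinguished
import Mathlib.RingTheory.Polynomial.Eisenstein.IsIntegral
import Mathlib.RingTheory.Polynomial.Cyclotomic.Basic
import Mathlib.RingTheory.DiscreteValuationRing.Basic
import Mathlib.RingTheory.AdjoinRoot
import HarnessLib

/-!
# X11b at `p = 3` (team N8/O2), LINE-W sub-target S16 = LW-L3′ DENSITY LEMMA, part (a): a nonzero
# power series over a complete DVR of residue characteristic `p` is divisible by `Φ_{p^{n+1}}(1+X)`
# for only finitely many `n` — "vanishes at only finitely many `ζ − 1`, `ζ ∈ μ_{p^∞}`"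
# (cell `b2b-bsdres`, team `x11b3`, seat p2; LEAD DEAL #6 (R6-10))

HONEST FRAMING (verbatim, cell `b2b-bsdres`, run/shared/lean/b2b/bsd-rank1-residual/): the goal of
the cell is to DELETE the COMBINATION-SHAPED residual classes for ALL analytic-rank `≤ 1` curves
over `ℚ` — "full BSD formula for every rank `≤ 1` curve in class `C`" assembled STRICTLY from
published theorems — so that the rank-`≤ 1` remainder becomes exactly the CONSTRUCTION-SHAPED
classes, which are TYPED (missing-input Props), NOT attempted; this is not "finishing BSD".
Research route (team N8/O2: STEP L at `3 ‖ N`, LINE W); PURE ALGEBRA; nothing booked; no label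
touched; X11b@3 stays OPEN (RESIDUAL-MAP §I O2). THEOREMS ONLY; no definition; no named fact;
no `sorry`.

HONEST LABEL (verbatim, LEAD DEAL #6 (R6-10)): 'certifies W3-INH's DENSITY step at p = 3 ONLY;
does NOT make MI-W3 available at 3 (tame datum ⊥ B-EW3; (β) vacuous at 3 as printed — kernel
p252575); LINE W's status string is unchanged by this file'.

## What (the `p = 3` substitute for Wan, ANT 14 (2020) §5.8's only use of `p ≥ 5`
## [arXiv:1408.4044 p0023 L40–L42; r1 LINE-W v1.9 W3-INH], in the ONE-VARIABLE form (a);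
## the two-variable torsion-translate form (b) follows r1's signature in LINE-W v1.9c §LW-L3′)

Everything is ALGEBRA — no `p`-adic analysis, no evaluation of power series: for a primitive
`p^{n+1}`-th root of unity `ζ`, "`f(ζ − 1) = 0`" is read as the divisibility of `f` by the minimal
polynomial of `ζ − 1`, a DISTINGUISHED polynomial; over a coefficient ring in which
`Φ_{p^{n+1}}(1 + X)` stays irreducible (`ℤ_p`; any `𝒪_L` with `L ∩ ℚ_p(μ_{p^∞}) = ℚ_p`) that
minimal polynomial is `Φ_{p^{n+1}}(1 + X)` itself (Eisenstein), and in general each irreducible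
factor of `Φ_{p^{n+1}}(1+X)` over `𝒪_L` is distinguished of degree `≥ φ(p^{n+1})/[L : ℚ_p]`. The
whole file is ONE inequality — a distinguished divisor of `f` has degree `≤ λ(f)` — and its
bookkeeping:

* §1 `Density.natDegree_le_order_map_of_isDistinguishedAt_dvd` — ANY commutative ring `A`, ideal
  `I ≠ ⊤`, `g ∈ A[X]` distinguished at `I`, `g ∣ f` in `A⟦X⟧` ⟹ `deg g ≤ ord_X (f mod I)` (reduce
  mod `I`: `ḡ = X^{deg g}`, Mathlib `IsDistinguishedAt.map_eq_X_pow`, `PowerSeries.le_order_mul`).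
  Informative iff `f mod I ≠ 0` ("`μ(f) = 0`"); then `ord_X(f mod 𝔪) = λ(f)`, the Weierstrass degree.
* §2 `Density.dvd_of_isDistinguishedAt_dvd_smul` — `A` a domain, `I`-adically complete, `g`
  distinguished at `I`, `a ≠ 0`: `g ∣ a • f ⟹ g ∣ f` (`A⟦X⟧/(g) ≅ A[X]/(g)` is a free `A`-module:
  Mathlib `IsDistinguishedAt.algEquivQuotient` (Weierstrass division) + `Monic.free_quotient`).
* §3 `Density.exists_eq_smul_of_ne_zero` — `A` a DVR, `f ≠ 0` ⟹ `f = ϖ^μ • f₀` with `f₀ mod 𝔪 ≠ 0`.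
* §4 `Density.isDistinguishedAt_cyclotomic_comp_X_add_one` — `(p : A) ∈ I` ⟹ `Φ_{p^{n+1}}(X + 1)`
  (base-changed from `ℤ`) is distinguished at `I`, of degree `p^n (p − 1)` (Mathlib
  `cyclotomic_prime_pow_comp_X_add_one_isEisensteinAt`).
* §5 `Density.finite_setOf_cyclotomic_comp_dvd_of_map_ne_zero` (any `A`, `f mod I ≠ 0`) and
  **`Density.finite_setOf_cyclotomic_comp_dvd`** (= the dealt `Three.finite_torsionRoots_of_ne_zero`):
  `A` a complete DVR with `(p : A) ∈ 𝔪` (`ℤ_p`, `𝒪_L` for `L/ℚ_p` finite), `f ∈ A⟦X⟧`, `f ≠ 0` ⟹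
  `{n | Φ_{p^{n+1}}(1 + X) ∣ f}` is finite (indeed `p^n (p−1) ≤ λ(f₀)`).

What this file is NOT: no statement about `L`-functions, Selmer groups or any class; it does not
touch MI-W3 / W2 / the status string of LINE W (see the HONEST LABEL); nothing booked.

References: X. Wan, *Iwasawa main conjecture for Rankin–Selberg p-adic L-functions*, Algebra &
Number Theory 14 (2020) §5.8 [Wan2020]; L. C. Washington, *Introduction to Cyclotomic Fields*,
GTM 83, §7.1 (Weierstrass preparation, Prop. 7.2–7.3; distinguished polynomials) [Washington1997];
S. Lang, *Cyclotomic Fields I and II*, Ch. 5 §2 [Lang1990]; team files `cells/x11b3/LINE-W.md`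
v1.9 (W3-INH, LW-L3′), `cells/x11b3/OWNERS.md` LEAD DEAL #6 (R6-10).
-/

open Polynomial
open scoped PowerSeries

namespace Summit.BirchSwinnertonDyer.Rank1Residual.X11b.Three.Density

/-! ### §1 A distinguished divisor of `f` has degree at most `ord_X (f mod I)` -/

/-- **Degree bound for distinguished divisors.** If `g ∈ A[X]` is distinguished at an ideal
`I ≠ ⊤` (monic, lower coefficients in `I`) and `g ∣ f` in `A⟦X⟧`, then
`deg g ≤ ord_X (f mod I)`: modulo `I`, `g ≡ X^{deg g}`, so `X^{deg g}` divides `f mod I`. ANY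
commutative ring; the bound is informative exactly when `f mod I ≠ 0`.
[cite: Washington1997, §7.1 (Prop. 7.2)] -/
theorem natDegree_le_order_map_of_isDistinguishedAt_dvd {A : Type*} [CommRing A] {I : Ideal A}
    (hI : I ≠ ⊤) {g : A[X]} (hg : g.IsDistinguishedAt I) {f : A⟦X⟧} (hdvd : (g : A⟦X⟧) ∣ f) :
    (g.natDegree : ℕ∞) ≤ (f.map (Ideal.Quotient.mk I)).order := by
  obtain ⟨h, rfl⟩ := hdvd
  haveI : Nontrivial (A ⧸ I) := Ideal.Quotient.nontrivial_iff.mpr hI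
  have hmap : ((g : A⟦X⟧) * h).map (Ideal.Quotient.mk I) =
      (PowerSeries.X : (A ⧸ I)⟦X⟧) ^ g.natDegree * h.map (Ideal.Quotient.mk I) := by
    rw [map_mul, ← Polynomial.polynomial_map_coe, hg.map_eq_X_pow, Polynomial.coe_pow,
      Polynomial.coe_X]
  rw [hmap]
  calc (g.natDegree : ℕ∞) = ((PowerSeries.X : (A ⧸ I)⟦X⟧) ^ g.natDegree).order :=
        (PowerSeries.order_X_pow _).symm
    _ ≤ ((PowerSeries.X : (A ⧸ I)⟦X⟧) ^ g.natDegree).order + (h.map (Ideal.Quotient.mk I)).order :=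
        le_self_add
    _ ≤ _ := PowerSeries.le_order_mul _ _

/-! ### §2 Distinguished polynomials are prime to the constants: `g ∣ a • f ⇒ g ∣ f` -/

/-- **`A⟦X⟧/(g)` is a torsion-free `A`-module for `g` distinguished** (`A` a domain, complete for
the ideal at which `g` is distinguished): `g ∣ a • f` with `a ≠ 0` forces `g ∣ f`. Proof: Weierstrass
division identifies `A⟦X⟧/(g)` with `A[X]/(g)` (Mathlib `Polynomial.IsDistinguishedAt.algEquivQuotient`),
a FREE `A`-module (`Polynomial.Monic.free_quotient`), on which a non-zero scalar acts injectively.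
[cite: Washington1997, §7.1 (Prop. 7.2)] [cite: Lang1990, Ch. 5 §2 Thm. 2.1] -/
theorem dvd_of_isDistinguishedAt_dvd_smul {A : Type*} [CommRing A] [IsDomain A] {I : Ideal A}
    [IsAdicComplete I A] {g : A[X]} (hg : g.IsDistinguishedAt I) {a : A} (ha : a ≠ 0)
    {f : A⟦X⟧} (hdvd : (g : A⟦X⟧) ∣ a • f) : (g : A⟦X⟧) ∣ f := by
  haveI : Module.Free A (A[X] ⧸ Ideal.span {g}) := hg.monic.free_quotient
  haveI : Module.Free A (A⟦X⟧ ⧸ Ideal.span {(g : A⟦X⟧)}) :=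
    Module.Free.of_equiv hg.algEquivQuotient.toLinearEquiv
  have h0 : (Ideal.Quotient.mk (Ideal.span {(g : A⟦X⟧)})) (a • f) = 0 := by
    rw [Ideal.Quotient.eq_zero_iff_mem, Ideal.mem_span_singleton]
    exact hdvd
  have h1 : a • (Ideal.Quotient.mk (Ideal.span {(g : A⟦X⟧)})) f = 0 := by
    rw [← Ideal.Quotient.mkₐ_eq_mk A, ← map_smul, Ideal.Quotient.mkₐ_eq_mk]
    exact h0
  rcases smul_eq_zero.mp h1 with h | h
  · exact absurd h ha
  · rw [Ideal.Quotient.eq_zero_iff_mem, Ideal.mem_span_singleton] at h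
    exact h

/-! ### §3 Content: over a DVR, `f ≠ 0` is `ϖ^μ • f₀` with `f₀ mod 𝔪 ≠ 0` -/

/-- **Removing the `μ`-invariant.** Over a discrete valuation ring `A`, a non-zero power series
`f` is `a • f₀` with `a ≠ 0` (a power of the uniformizer) and `f₀ mod 𝔪 ≠ 0` (some coefficient of
`f₀` is a unit): take `μ` minimal with some coefficient of `f` outside `𝔪^{μ+1}`.
[cite: Washington1997, §7.1 (before Prop. 7.2)] -/
theorem exists_eq_smul_of_ne_zero {A : Type*} [CommRing A] [IsDomain A]
    [IsDiscreteValuationRing A] {f : A⟦X⟧} (hf : f ≠ 0) :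
    ∃ (a : A) (f₀ : A⟦X⟧), a ≠ 0 ∧ f = a • f₀ ∧ f₀.map (IsLocalRing.residue A) ≠ 0 := by
  obtain ⟨ϖ, hϖ⟩ := IsDiscreteValuationRing.exists_irreducible A
  have hmax : IsLocalRing.maximalIdeal A = Ideal.span {ϖ} :=
    (IsDiscreteValuationRing.irreducible_iff_uniformizer ϖ).mp hϖ
  -- some coefficient of `f` lies outside some power of `𝔪`
  have hex : ∃ μ : ℕ, ∃ i : ℕ, PowerSeries.coeff i f ∉ IsLocalRing.maximalIdeal A ^ (μ + 1) := by
    obtain ⟨i, hi⟩ : ∃ i, PowerSeries.coeff i f ≠ 0 := by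
      obtain ⟨i, hi⟩ := not_forall.mp (mt PowerSeries.ext hf)
      exact ⟨i, by simpa using hi⟩
    obtain ⟨n, u, hu⟩ := IsDiscreteValuationRing.eq_unit_mul_pow_irreducible hi hϖ
    refine ⟨n, i, fun hmem => hϖ.not_isUnit ?_⟩
    rw [hmax, Ideal.span_singleton_pow, Ideal.mem_span_singleton, hu] at hmem
    obtain ⟨c, hc⟩ := hmem
    -- `u ϖ^n = ϖ^(n+1) c` ⇒ `u = ϖ c`
    have hc' : (u : A) = ϖ * c := by
      have hϖn : ϖ ^ n ≠ 0 := pow_ne_zero _ hϖ.ne_zero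
      apply mul_right_cancel₀ hϖn
      calc (u : A) * ϖ ^ n = ϖ ^ (n + 1) * c := hc
        _ = ϖ * c * ϖ ^ n := by ring
    exact isUnit_of_mul_isUnit_left (hc' ▸ u.isUnit)
  classical
  let μ := Nat.find hex
  obtain ⟨i₀, hi₀⟩ : ∃ i, PowerSeries.coeff i f ∉ IsLocalRing.maximalIdeal A ^ (μ + 1) :=
    Nat.find_spec hex
  -- every coefficient lies in `𝔪^μ = (ϖ^μ)`
  have hall : ∀ i, PowerSeries.coeff i f ∈ IsLocalRing.maximalIdeal A ^ μ := by
    intro i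
    rcases Nat.eq_zero_or_pos μ with h0 | hpos
    · rw [h0, pow_zero, Ideal.one_eq_top]; exact Submodule.mem_top
    · by_contra hni
      have hlt : μ - 1 < μ := Nat.sub_lt hpos one_pos
      have := Nat.find_min hex hlt
      exact this ⟨i, by rwa [Nat.sub_add_cancel hpos]⟩
  have hdvd : ∀ i, ϖ ^ μ ∣ PowerSeries.coeff i f := fun i => by
    have := hall i
    rwa [hmax, Ideal.span_singleton_pow, Ideal.mem_span_singleton] at this
  choose c hc using hdvd
  refine ⟨ϖ ^ μ, PowerSeries.mk c, pow_ne_zero _ hϖ.ne_zero, ?_, ?_⟩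
  · ext i
    rw [PowerSeries.coeff_smul, PowerSeries.coeff_mk, smul_eq_mul]
    exact hc i
  · intro h0
    apply hi₀
    have hci : IsLocalRing.residue A (c i₀) = 0 := by
      have := congrArg (PowerSeries.coeff i₀) h0
      rwa [PowerSeries.coeff_map, PowerSeries.coeff_mk, map_zero] at this
    rw [IsLocalRing.residue_eq_zero_iff, hmax, Ideal.mem_span_singleton] at hci
    obtain ⟨d, hd⟩ := hci
    rw [hc i₀, hd, hmax, Ideal.span_singleton_pow, Ideal.mem_span_singleton]
    exact ⟨d, by ring⟩

/-! ### §4 `Φ_{p^{n+1}}(X + 1)` is distinguished wherever `p` lies in the ideal -/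

/-- **`Φ_{p^{n+1}}(X + 1)` is a distinguished polynomial of degree `p^n (p − 1)`** over any
commutative ring `A` at any ideal `I ∋ p` (Eisenstein at `p` over `ℤ`, Mathlib
`cyclotomic_prime_pow_comp_X_add_one_isEisensteinAt`; base change along `ℤ → A`).
[cite: Washington1997, §7.1; Lemma 1.4 (Eisenstein criterion for `Φ_{p^n}`)] -/
theorem isDistinguishedAt_cyclotomic_comp_X_add_one {A : Type*} [CommRing A] {I : Ideal A}
    {p : ℕ} [hp : Fact p.Prime] (hpI : (p : A) ∈ I) (n : ℕ) :
    (((cyclotomic (p ^ (n + 1)) ℤ).comp (X + 1)).map (Int.castRingHom A)).IsDistinguishedAt I := by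
  have hE := cyclotomic_prime_pow_comp_X_add_one_isEisensteinAt p n
  have hq : (X + 1 : ℤ[X]).Monic := by simpa using monic_X_add_C (1 : ℤ)
  have hqdeg : (X + 1 : ℤ[X]).natDegree = 1 := by simpa using natDegree_X_add_C (1 : ℤ)
  have hmon : ((cyclotomic (p ^ (n + 1)) ℤ).comp (X + 1)).Monic :=
    (cyclotomic.monic _ ℤ).comp hq (by rw [hqdeg]; exact one_ne_zero)
  refine ⟨⟨fun {k} hk => ?_⟩, hmon.map _⟩
  replace hk := lt_of_lt_of_le hk (natDegree_map_le)
  rw [Polynomial.coeff_map]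
  obtain ⟨c, hc⟩ := Ideal.mem_span_singleton'.mp (hE.mem hk)
  rw [← hc, map_mul, eq_intCast, eq_intCast, Int.cast_natCast]
  exact I.mul_mem_left _ hpI

/-- The degree of `Φ_{p^{n+1}}(X + 1)` (base-changed to `A`) is `p^n (p − 1)`.
[cite: Washington1997, §7.1] -/
theorem natDegree_cyclotomic_comp_X_add_one {A : Type*} [CommRing A] [Nontrivial A]
    {p : ℕ} [hp : Fact p.Prime] (n : ℕ) :
    (((cyclotomic (p ^ (n + 1)) ℤ).comp (X + 1)).map (Int.castRingHom A)).natDegree =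
      p ^ n * (p - 1) := by
  have hq : (X + 1 : ℤ[X]).Monic := by simpa using monic_X_add_C (1 : ℤ)
  have hqdeg : (X + 1 : ℤ[X]).natDegree = 1 := by simpa using natDegree_X_add_C (1 : ℤ)
  have hmon : ((cyclotomic (p ^ (n + 1)) ℤ).comp (X + 1)).Monic :=
    (cyclotomic.monic _ ℤ).comp hq (by rw [hqdeg]; exact one_ne_zero)
  rw [hmon.natDegree_map, natDegree_comp, natDegree_cyclotomic, Nat.totient_prime_pow_succ hp.out,
    hqdeg, mul_one]

/-! ### §5 Finiteness -/

/-- **Finitely many `Φ_{p^{n+1}}(1 + X)` divide a power series with a unit coefficient.** For ANY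
commutative ring `A`, ideal `I ∋ p`, `I ≠ ⊤`, and `f ∈ A⟦X⟧` with `f mod I ≠ 0`: the set of `n` with
`Φ_{p^{n+1}}(1 + X) ∣ f` is finite — each such `n` has `n < p^n (p−1) ≤ ord_X (f mod I)` (§1, §4).
[cite: Washington1997, §7.1 (Prop. 7.2, Lemma 7.4-type counting)] [cite: Wan2020, §5.8] -/
theorem finite_setOf_cyclotomic_comp_dvd_of_map_ne_zero {A : Type*} [CommRing A] {I : Ideal A}
    (hI : I ≠ ⊤) {p : ℕ} [hp : Fact p.Prime] (hpI : (p : A) ∈ I) {f : A⟦X⟧}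
    (hf : f.map (Ideal.Quotient.mk I) ≠ 0) :
    {n : ℕ | ((((cyclotomic (p ^ (n + 1)) ℤ).comp (X + 1)).map (Int.castRingHom A) : A[X]) :
      A⟦X⟧) ∣ f}.Finite := by
  haveI : Nontrivial (A ⧸ I) := Ideal.Quotient.nontrivial_iff.mpr hI
  haveI : Nontrivial A := (Ideal.Quotient.mk I).domain_nontrivial
  obtain ⟨l, hl⟩ : ∃ l : ℕ, (l : ℕ∞) = (f.map (Ideal.Quotient.mk I)).order :=
    ENat.ne_top_iff_exists.mp (by rwa [Ne, PowerSeries.order_eq_top])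
  refine (Set.finite_lt_nat l).subset fun n hn => ?_
  have h1 := natDegree_le_order_map_of_isDistinguishedAt_dvd hI
    (isDistinguishedAt_cyclotomic_comp_X_add_one hpI n) hn
  rw [natDegree_cyclotomic_comp_X_add_one, ← hl, Nat.cast_le] at h1
  -- `n < p^n ≤ p^n (p - 1)`
  have h2 : n < p ^ n := Nat.lt_pow_self hp.out.one_lt
  have h3 : p ^ n ≤ p ^ n * (p - 1) :=
    Nat.le_mul_of_pos_right _ (Nat.sub_pos_of_lt hp.out.one_lt)
  exact lt_of_lt_of_le h2 (h3.trans h1)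

/-- **LW-L3′ (a): a non-zero power series over a complete DVR of residue characteristic `p` is
divisible by `Φ_{p^{n+1}}(1 + X)` for only finitely many `n`** — over `ℤ_p`, or any `𝒪_L` in which
the `Φ_{p^{n+1}}(1+X)` stay irreducible, this says exactly that `f` vanishes at `ζ − 1` for only
finitely many `ζ ∈ μ_{p^∞}`; the count is `p^n (p − 1) ≤ λ(f₀)`, `f = ϖ^μ f₀`. Proof: §3 removes
`ϖ^μ`, §2 keeps the divisibility, §5's unit-content case concludes. (HONEST LABEL: certifies
W3-INH's density step at `p = 3` only; MI-W3 is NOT made available at `3`.)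
[cite: Washington1997, §7.1 (Prop. 7.2–7.3)] [cite: Wan2020, §5.8] -/
theorem finite_setOf_cyclotomic_comp_dvd {A : Type*} [CommRing A] [IsDomain A]
    [IsDiscreteValuationRing A] [IsAdicComplete (IsLocalRing.maximalIdeal A) A]
    {p : ℕ} [Fact p.Prime] (hp : (p : A) ∈ IsLocalRing.maximalIdeal A) {f : A⟦X⟧} (hf : f ≠ 0) :
    {n : ℕ | ((((cyclotomic (p ^ (n + 1)) ℤ).comp (X + 1)).map (Int.castRingHom A) : A[X]) :
      A⟦X⟧) ∣ f}.Finite := by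
  obtain ⟨a, f₀, ha, rfl, hf₀⟩ := exists_eq_smul_of_ne_zero hf
  have hI : IsLocalRing.maximalIdeal A ≠ ⊤ := Ideal.IsPrime.ne_top inferInstance
  refine (finite_setOf_cyclotomic_comp_dvd_of_map_ne_zero hI hp (f := f₀) hf₀).subset ?_
  intro n hn
  exact dvd_of_isDistinguishedAt_dvd_smul (isDistinguishedAt_cyclotomic_comp_X_add_one hp n) ha hn

end Summit.BirchSwinnertonDyer.Rank1Residual.X11b.Three.Density
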